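import Literature.Algebra.Homology.DiscreteRepShapiroPairing
import Literature.Algebra.Homology.DiscreteRepProfinite
import Mathlib.Topology.Algebra.Category.ProfiniteGrp.Completion
import HarnessLib

/-!
# The presentation `0 → M → Coind_U^Γ Res_U M → M'' → 0` of a discrete module by a coinduced module
# (Milne ADT I, proof of Thm. 1.8: "we embed a general `M` into an exact sequence
# `0 → M → M_* → M₁ → 0` with `M_* = Hom(ℤ[G/U], M)`")

Topic `Algebra/Homology`; namespace `Literature.Algebra.Homology.DiscreteRep`.  Two definitions with
bodies (`trivIsoOfForall`, the identity isomorphism `T ≅ triv T.V` of an object with trivial action;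
`coindResSC`, the short complex `M → Coind Res M → coker`) and theorems; no named fact, no instance,
no `sorry`.  Sequel of `DiscreteRepOpenSubgroup` (`resD`, `coindD`, `resCoindAdj`),
`DiscreteRepCoresRes`, `DiscreteRepProfinite` (open normal subgroups fixing finitely many vectors).

For `Γ` a topological group, `U ≤ Γ` open of finite index and `M ∈ C_Γ = DiscreteRepCat k Γ`:

* `exists_openNormalSubgroup_forall_apply_eq` (`Γ` profinite, `M` of finite type over `k`): an open
  normal subgroup `U` acting trivially on `M` ("`U` an open normal subgroup of `G` such that `M^U = M`");
* `trivIsoOfForall`: an object `T ∈ C_Δ` on which `Δ` acts trivially is (identically) isomorphic to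
  `triv T.V`; `resTrivIso`: for `U` acting trivially on `M`, `Res_U M ≅ triv_U M.V`;
* the unit `η_M : M → Coind_U Res_U M` of `Res ⊣ Coind` is a monomorphism
  (`ι_map_resCoindAdj_unit_app`, `resCoindAdj_unit_injective`, `mono_resCoindAdj_unit`), the short
  exact sequence **`coindResSC_shortExact : 0 → M → Coind_U Res_U M → M'' → 0`**
  (`M'' = cokernel η_M`);
* finiteness: if `U` acts trivially on `M` and `M` is finite then `Coind_U Res_U M` and `M''` are
  finite (`finite_coind_of_forall`, `finite_coindResCokernel`) — the vectors of `Coind_U N` for a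
  `U`-trivial `N` are the functions on the finite coset space `U\Γ`.

Written for Route A of the Poitou–Tate programme of crux `stmt-BirchSwinnertonDyer-19295` (cell
`bsd-schneider-ideate`, seat door-c4 gen 15): Stage 2 of the abstract Thm. 1.8 (the ladder (1.9.1)
is applied to this short exact sequence, its middle column being Shapiro's
`Extʳ_Γ(Coind_U Res_U M, C) = Extʳ_U(Res_U M, Res_U C)` of `DiscreteRepShapiroPairing`).
HONEST FRAMING: homological algebra only; no arithmetic statement and no case of BSD is proved here.

## References
* J. S. Milne, *Arithmetic Duality Theorems* (2nd ed. 2006), I §1, proof of Theorem 1.8 (p. 22) and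
  I (0.3). [MilneADT2006]
* D. Harari, *Galois Cohomology and Class Field Theory*, Universitext (2020), §4.3 (1)–(4) (p. 97),
  Remark 4.15, proof of Corollary 4.21. [Harari2020]
-/

noncomputable section

universe u

namespace Literature.Algebra.Homology

namespace DiscreteRep

open CategoryTheory CategoryTheory.Limits CategoryTheory.Abelian Representation

/-! ## §1 An open normal subgroup acting trivially on a module of finite type -/

section Trivial

variable {k Γ : Type u} [CommRing k] [Group Γ] [TopologicalSpace Γ] [IsTopologicalGroup Γ]

/-- **Over a profinite group, a discrete module of finite type is fixed pointwise by an open normal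
subgroup** (Milne: "`U` an open normal subgroup of `G` such that `M^U = M`").
[cite: MilneADT2006, I Theorem 1.8 (proof)][cite: Harari2020, §4.3, proof of Corollary 4.21 and Remark 4.15] -/
theorem exists_openNormalSubgroup_forall_apply_eq [CompactSpace Γ] [TotallyDisconnectedSpace Γ]
    (M : DiscreteRepCat k Γ) [Module.Finite k M.obj.V] :
    ∃ U : OpenNormalSubgroup Γ, ∀ u : Γ, u ∈ (U : Subgroup Γ) → ∀ x : M.obj.V, M.obj.ρ u x = x := by
  obtain ⟨s, hs⟩ := Module.Finite.fg_top (R := k) (M := M.obj.V)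
  obtain ⟨U, hU⟩ := exists_openNormalSubgroup_forall_mem_invariants M s
  refine ⟨U, fun u hu x => ?_⟩
  have hle : (⊤ : Submodule k M.obj.V) ≤ invariants (M.obj.ρ.comp (U : Subgroup Γ).subtype) := by
    rw [← hs, Submodule.span_le]
    intro y hy
    exact hU y hy
  exact (mem_invariants _ x).1 (hle Submodule.mem_top) ⟨u, hu⟩

/-- **An object with trivial action is (identically) isomorphic to the trivial object on its vectors.**
[cite: Harari2020, §4.2] -/
def trivIsoOfForall {Δ : Type u} [Group Δ] [TopologicalSpace Δ] (T : DiscreteRepCat k Δ)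
    (hT : ∀ (g : Δ) (x : T.obj.V), T.obj.ρ g x = x) : T ≅ triv (k := k) (Γ := Δ) T.obj.V where
  hom := ObjectProperty.homMk (Rep.ofHom ⟨LinearMap.id, fun g => LinearMap.ext fun x => by
    change T.obj.ρ g x = x
    exact hT g x⟩)
  inv := ObjectProperty.homMk (Rep.ofHom ⟨LinearMap.id, fun g => LinearMap.ext fun x => by
    change x = T.obj.ρ g x
    exact (hT g x).symm⟩)
  hom_inv_id := ObjectProperty.hom_ext _ (Rep.hom_ext (DFunLike.ext _ _ fun _ => rfl))
  inv_hom_id := ObjectProperty.hom_ext _ (Rep.hom_ext (DFunLike.ext _ _ fun _ => rfl))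

/-- Formula: `trivIsoOfForall` is the identity on vectors. [cite: Harari2020, §4.2] -/
@[simp]
theorem trivIsoOfForall_hom_hom_hom_apply {Δ : Type u} [Group Δ] [TopologicalSpace Δ]
    (T : DiscreteRepCat k Δ) (hT : ∀ (g : Δ) (x : T.obj.V), T.obj.ρ g x = x) (x : T.obj.V) :
    (trivIsoOfForall T hT).hom.hom.hom x = x := rfl

variable (U : Subgroup Γ)

omit [IsTopologicalGroup Γ] in
/-- The restriction to `U` of a module on which `U` acts trivially has trivial action.
[cite: MilneADT2006, I Theorem 1.8 (proof)] -/
theorem resD_obj_ρ_apply_eq (M : DiscreteRepCat k Γ)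
    (hU : ∀ u : Γ, u ∈ U → ∀ x : M.obj.V, M.obj.ρ u x = x) (u : U) (x : M.obj.V) :
    ((resD k U).obj M).obj.ρ u x = x :=
  hU u u.2 x

/-- **`Res_U M ≅ triv_U (M.V)`** for `U` acting trivially on `M`. [cite: MilneADT2006, I Theorem 1.8 (proof)] -/
def resTrivIso (M : DiscreteRepCat k Γ) (hU : ∀ u : Γ, u ∈ U → ∀ x : M.obj.V, M.obj.ρ u x = x) :
    (resD k U).obj M ≅ triv (k := k) (Γ := U) M.obj.V :=
  trivIsoOfForall ((resD k U).obj M) (resD_obj_ρ_apply_eq U M hU)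

end Trivial

/-! ## §2 The unit `M → Coind_U Res_U M` is a monomorphism -/

section Unit

variable {k Γ : Type u} [CommRing k] [Group Γ] [TopologicalSpace Γ] [IsTopologicalGroup Γ]
  (U : Subgroup Γ) (hU : IsOpen (U : Set Γ)) [U.FiniteIndex]

/-- Under `ι : C_Γ ⥤ Rep k Γ` the unit of `resCoindAdj` is Mathlib's unit of `Rep.resCoindAdjunction`.
[cite: Harari2020, §4.3 (1)] -/
theorem ι_map_resCoindAdj_unit_app (M : DiscreteRepCat k Γ) :
    (ι k Γ).map ((resCoindAdj U hU).unit.app M) = (Rep.resCoindAdjunction k U.subtype).unit.app M.obj := by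
  refine (Adjunction.map_restrictFullyFaithful_unit_app (Rep.resCoindAdjunction k U.subtype)
    (iC := ι k Γ) (iD := ι k U) (L := resD k U) (R := coindD k U hU)
    (isDiscrete k Γ).fullyFaithfulι (isDiscrete k U).fullyFaithfulι (Iso.refl _) (Iso.refl _) M).trans ?_
  erw [CategoryTheory.Functor.map_id, Category.comp_id]
  rfl

/-- Formula for the unit: `(η_M m) g = g • m` (the function `g ↦ ρ(g) m` on `Γ`).
[cite: Harari2020, §4.3 (1)] -/
theorem resCoindAdj_unit_apply_coe (M : DiscreteRepCat k Γ) (m : M.obj.V) (g : Γ) :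
    (((resCoindAdj U hU).unit.app M).hom.hom m).1 g = M.obj.ρ g m := by
  change (((ι k Γ).map ((resCoindAdj U hU).unit.app M)).hom m).1 g = _
  rw [ι_map_resCoindAdj_unit_app, Adjunction.mkOfHomEquiv_unit_app]
  rfl

/-- **The unit `η_M : M → Coind_U Res_U M` is injective on vectors** (evaluate at `1`).
[cite: MilneADT2006, I Theorem 1.8 (proof)][cite: Harari2020, §4.3 (1)] -/
theorem resCoindAdj_unit_injective (M : DiscreteRepCat k Γ) :
    Function.Injective ((resCoindAdj U hU).unit.app M).hom.hom := by
  intro m m' h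
  have h1 := congrArg (fun f => f.1 (1 : Γ)) h
  simp only [resCoindAdj_unit_apply_coe, map_one] at h1
  exact h1

/-- **`η_M` is a monomorphism of `C_Γ`.** [cite: MilneADT2006, I Theorem 1.8 (proof)] -/
theorem mono_resCoindAdj_unit (M : DiscreteRepCat k Γ) : Mono ((resCoindAdj U hU).unit.app M) := by
  apply (ι k Γ).mono_of_mono_map
  rw [Rep.mono_iff_injective]
  exact resCoindAdj_unit_injective U hU M

/-! ## §3 The short exact sequence `0 → M → Coind_U Res_U M → M'' → 0` -/

/-- **The short complex `M —η→ Coind_U Res_U M —π→ M''`**, `M'' = coker η`.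
[cite: MilneADT2006, I Theorem 1.8 (proof)] -/
abbrev coindResSC (M : DiscreteRepCat k Γ) : ShortComplex (DiscreteRepCat k Γ) :=
  ShortComplex.mk ((resCoindAdj U hU).unit.app M) (cokernel.π ((resCoindAdj U hU).unit.app M))
    (cokernel.condition _)

/-- **`0 → M → Coind_U Res_U M → M'' → 0` is short exact.** [cite: MilneADT2006, I Theorem 1.8 (proof)] -/
theorem coindResSC_shortExact (M : DiscreteRepCat k Γ) : (coindResSC U hU M).ShortExact :=
  haveI := mono_resCoindAdj_unit U hU M
  { exact := ShortComplex.exact_cokernel _ }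

/-- `π : Coind Res M → M''` is surjective on vectors. [cite: MilneADT2006, I Theorem 1.8 (proof)] -/
theorem coindResSC_g_surjective (M : DiscreteRepCat k Γ) :
    Function.Surjective (coindResSC U hU M).g.hom.hom :=
  (Rep.epi_iff_surjective ((ι k Γ).map (cokernel.π ((resCoindAdj U hU).unit.app M)))).1 inferInstance

/-! ## §4 Finiteness of `Coind_U N` for a `U`-trivial `N` -/

/-- A vector of `Coind_U^Γ N` (a function `f : Γ → N` with `f (u g) = u • f g`) for a `U`-TRIVIAL `N`
is determined by its values on a set of right-coset representatives.
[cite: Harari2020, Proposition 1.39][cite: MilneADT2006, I (0.3)] -/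
theorem coind_injective_out (N : DiscreteRepCat k U) (hN : ∀ (u : U) (x : N.obj.V), N.obj.ρ u x = x) :
    Function.Injective (fun (f : ((coindD k U hU).obj N).obj.V) (q : Quotient (QuotientGroup.rightRel U)) =>
      (f.1 : Γ → N.obj.V) q.out) := by
  intro f f' hff'
  apply Subtype.ext
  funext x
  have hx : x * (Quotient.mk (QuotientGroup.rightRel U) x).out⁻¹ ∈ U := by
    have := Quotient.mk_out (s := QuotientGroup.rightRel U) x
    rw [QuotientGroup.rightRel_apply] at this
    exact this
  have key : ∀ φ : ((coindD k U hU).obj N).obj.V,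
      (φ.1 : Γ → N.obj.V) x = φ.1 (Quotient.mk (QuotientGroup.rightRel U) x).out := by
    intro φ
    have hφ := (Representation.mem_coindV _ _ _).1 φ.2 ⟨_, hx⟩
      (Quotient.mk (QuotientGroup.rightRel U) x).out
    have h1 : (U.subtype ⟨_, hx⟩ : Γ) * (Quotient.mk (QuotientGroup.rightRel U) x).out = x := by simp
    rw [h1] at hφ
    rw [hφ]
    exact hN _ _
  rw [key f, key f']
  exact congrFun hff' _

/-- **`Coind_U^Γ N` is finite** for `N` finite with trivial `U`-action (`U` of finite index).
[cite: Harari2020, Proposition 1.39][cite: MilneADT2006, I (0.3)] -/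
theorem finite_coind_of_forall (N : DiscreteRepCat k U) (hN : ∀ (u : U) (x : N.obj.V), N.obj.ρ u x = x)
    [Finite N.obj.V] : Finite ((coindD k U hU).obj N).obj.V := by
  haveI : Finite (Quotient (QuotientGroup.rightRel U)) :=
    Finite.of_equiv _ (QuotientGroup.quotientRightRelEquivQuotientLeftRel U).symm
  haveI : Finite ((ι k U).obj N).V := ‹Finite N.obj.V›
  exact Finite.of_injective _ (coind_injective_out U hU N hN)

/-- **`Coind_U Res_U M` is finite** when `M` is finite and `U` acts trivially on `M`.
[cite: MilneADT2006, I Theorem 1.8 (proof)] -/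
theorem finite_coindRes (M : DiscreteRepCat k Γ) (hUM : ∀ u : Γ, u ∈ U → ∀ x : M.obj.V, M.obj.ρ u x = x)
    [Finite M.obj.V] : Finite ((coindD k U hU).obj ((resD k U).obj M)).obj.V :=
  haveI : Finite ((resD k U).obj M).obj.V := ‹Finite M.obj.V›
  finite_coind_of_forall U hU ((resD k U).obj M) (resD_obj_ρ_apply_eq U M hUM)

/-- **`M'' = coker(M → Coind_U Res_U M)` is finite** when `M` is finite and `U` acts trivially on `M`.
[cite: MilneADT2006, I Theorem 1.8 (proof)] -/
theorem finite_coindResCokernel (M : DiscreteRepCat k Γ)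
    (hUM : ∀ u : Γ, u ∈ U → ∀ x : M.obj.V, M.obj.ρ u x = x) [Finite M.obj.V] :
    Finite (coindResSC U hU M).X₃.obj.V :=
  haveI : Finite (coindResSC U hU M).X₂.obj.V := finite_coindRes U hU M hUM
  Finite.of_surjective _ (coindResSC_g_surjective U hU M)

end Unit

/-! ## §5 Open normal subgroups of a compact group have finite index -/

/-- An open normal subgroup of a compact group has finite index. [cite: Harari2020, §4.3 (p. 97)] -/
theorem finiteIndex_of_openNormalSubgroup {Γ : Type u} [Group Γ] [TopologicalSpace Γ]
    [IsTopologicalGroup Γ] [CompactSpace Γ] (U : OpenNormalSubgroup Γ) : (U : Subgroup Γ).FiniteIndex :=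
  Subgroup.finiteIndex_of_finite_quotient

end DiscreteRep

end Literature.Algebra.Homology
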